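import Mathlib
import Literature.NumberTheory.LFunctions.VinogradovZetaSumEstimate
import HarnessLib

/-!
# Route LiouvilleSarnak — support `AlignedTypeI` (stmt-ValiantsHypothesis-21040), line `characters_mod_2n`:
# the Korobov factors for phase coefficients with a `2`-power denominator

Brick (B1) of the Korobov side of `HS` (short character sums to the modulus `q = 2^j`, the depth-aspect
analogue of Ivić's Theorem 6.2).  In Korobov's bound (`VKZeta.norm_Usum_pow_le`)

  `|U|^{4k²} ≤ J_{k,r}(a)² a^{8k²−4k} ∏_m Σ_{|μ| ≤ A_m − 1} min(2A_m, 1/(2‖α_m μ‖))`, `A_m = k a^m`,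

the Postnikov phase of a primitive character mod `2^j` has coefficients `α_m ≡ b_m/2^{e_m} (mod 1)` with `b_m`
ODD (`…PostnikovOdd.lean`).  For such a coefficient the factor is bounded by Ivić's Lemma 6.5 for `2`-power
rationals (Bourgain 2013, (2.24)): the points `bμ/2^e`, `μ` in a window of `2^e` consecutive integers, are
`2^{−e}`-separated modulo `1`, so the tree's `Sieve.Vinogradov.sum_geomBound_le_of_separated` bounds each window by
`2V + 2^e(1 + log 2^e)`, and `[−(A−1), A−1]` is covered by `≤ (2A−1)/2^e + 1` windows.

* `twoPower_separated`, `sum_window_geomBound_le` — one window: `Σ_{μ ∈ [n₀, n₀ + 2^e)} min(V, 1/(2‖bμ/2^e‖)) ≤ 2V + 2^e(1 + log 2^e)`;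
* `mnSum_le_of_twoPower` — `Σ_{|μ| ≤ A−1} min(2A, 1/(2‖αμ‖)) ≤ ((2A−1)/2^e + 1)(4A + 2^e(1 + log 2^e))`;
* `mnSum_le_sq_mul_of_twoPower` — ★ the GOOD factors: if moreover `2^e ≤ A`, the factor is
  `≤ (2A)² · (4 + log 2^e)/2^e` (saving `≍ e·2^{−e}` against the trivial `(2A)²` of `VKZeta.mnSum_le_sq`).

HONEST FRAMING. Helper lemmas only (unconditional, pure real analysis on the tree's `VKZeta` objects); the leaf
`AlignedTypeI` is NOT closed here; nothing bears on `VP ≠ VNP` (NOT proved).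
-/

set_option linter.dupNamespace false

noncomputable section

namespace Summit.ValiantsHypothesis.ValiantsHypothesis.Theorems.LiouvilleSarnak.AlignedTypeI.CharactersModTwoN

open Finset Real
open Literature.NumberTheory.LFunctions
open Literature.NumberTheory.Sieve.Vinogradov (distInt geomBound geomBound_nonneg geomBound_neg geomBound_le
  distInt_nonneg sum_geomBound_le_of_separated)

/-! ### Separation of the points `bμ/2^e` -/

/-- For `b` odd, the points `bμ/2^e`, `μ` in a window of `2^e` consecutive integers, are `2^{−e}`-separated
modulo `1`. [folklore] -/
theorem twoPower_separated {b : ℤ} (hb : Odd b) (e : ℕ) (n₀ : ℤ) :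
    ∀ μ ∈ Ico n₀ (n₀ + 2 ^ e), ∀ μ' ∈ Ico n₀ (n₀ + 2 ^ e), μ ≠ μ' →
      1 / ((2 ^ e : ℕ) : ℝ) ≤ distInt ((b : ℝ) * μ / 2 ^ e - (b : ℝ) * μ' / 2 ^ e) := by
  intro μ hμ μ' hμ' hne
  have hμ1 := mem_Ico.1 hμ
  have hμ2 := mem_Ico.1 hμ'
  have hform : (b : ℝ) * μ / 2 ^ e - (b : ℝ) * μ' / 2 ^ e = (((b * (μ - μ') : ℤ)) : ℝ) / ((2 ^ e : ℕ) : ℝ) := by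
    push_cast; ring
  rw [hform]
  -- `‖p/Q‖ ≥ 1/Q` unless `Q ∣ p` (cf. `MoebiusWalsh.one_div_le_distInt_int_div`)
  set p : ℤ := b * (μ - μ') with hp
  set Q : ℕ := 2 ^ e with hQ
  suffices hndvd : ¬ (Q : ℤ) ∣ p by
    have hQr : (0 : ℝ) < Q := by positivity
    unfold distInt
    set n := round ((p : ℝ) / Q) with hn
    have hne' : p - n * Q ≠ 0 := by
      intro h
      apply hndvd
      exact ⟨n, by linarith⟩
    have h1 : (1 : ℝ) ≤ |(((p - n * Q : ℤ)) : ℝ)| := by exact_mod_cast Int.one_le_abs hne'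
    have heq : (p : ℝ) / Q - n = (((p - n * Q : ℤ)) : ℝ) / Q := by
      push_cast; field_simp
    rw [heq, abs_div, abs_of_pos hQr, le_div_iff₀ hQr, one_div_mul_cancel hQr.ne']
    exact h1
  intro hdvd
  rw [hQ, hp] at hdvd
  push_cast at hdvd
  -- `2^e` is coprime to the odd `b`, so `2^e ∣ μ − μ'`, impossible as `0 < |μ − μ'| < 2^e`
  have hcopN : Nat.Coprime (2 ^ e) b.natAbs :=
    Nat.Coprime.pow_left _ ((Int.natAbs_odd.2 hb).coprime_two_right).symm
  have hcop : IsCoprime ((2 : ℤ) ^ e) b := by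
    rw [Int.isCoprime_iff_gcd_eq_one, Int.gcd_eq_natAbs, Int.natAbs_pow]
    exact hcopN
  have hd : ((2 : ℤ) ^ e) ∣ (μ - μ') := hcop.dvd_of_dvd_mul_left hdvd
  rcases hd with ⟨c, hc⟩
  have h2e : (0 : ℤ) < 2 ^ e := by positivity
  rcases lt_trichotomy c 0 with hc0 | hc0 | hc0
  · have : μ - μ' ≤ -(2 ^ e) := by rw [hc]; nlinarith
    omega
  · rw [hc0, mul_zero] at hc
    exact hne (by omega)
  · have : 2 ^ e ≤ μ - μ' := by rw [hc]; nlinarith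
    omega

/-! ### One window and the whole range -/

/-- **One window**: for `b` odd, `V ≥ 0` and any `n₀`,
`Σ_{μ ∈ [n₀, n₀ + 2^e)} min(V, 1/(2‖bμ/2^e‖)) ≤ 2V + 2^e(1 + log 2^e)`. [cite: Ivic1985, Lemma 6.5] -/
theorem sum_window_geomBound_le {b : ℤ} (hb : Odd b) (e : ℕ) {V : ℝ} (hV : 0 ≤ V) (n₀ : ℤ) :
    ∑ μ ∈ Ico n₀ (n₀ + 2 ^ e), geomBound V ((b : ℝ) * μ / 2 ^ e) ≤
      2 * V + 2 ^ e * (1 + Real.log (2 ^ e)) := by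
  have hQ : (0 : ℝ) < ((2 ^ e : ℕ) : ℝ) := by positivity
  have hδ : (0 : ℝ) < 1 / ((2 ^ e : ℕ) : ℝ) := by positivity
  have hm : 1 / (2 * (1 / ((2 ^ e : ℕ) : ℝ))) ≤ ((2 ^ e : ℕ) : ℝ) := by
    rw [show 1 / (2 * (1 / ((2 ^ e : ℕ) : ℝ))) = ((2 ^ e : ℕ) : ℝ) / 2 by field_simp]
    linarith
  have h := sum_geomBound_le_of_separated (Ico n₀ (n₀ + 2 ^ e)) (fun μ : ℤ => (b : ℝ) * μ / 2 ^ e) hδ hm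
    (twoPower_separated hb e n₀) hV
  refine h.trans (le_of_eq ?_)
  push_cast
  rw [one_div_one_div]

/-- Sums of a nonnegative function over `T` consecutive windows of length `P`. [folklore] -/
theorem sum_Ico_windows_le {f : ℤ → ℝ} (hf : ∀ μ, 0 ≤ f μ) {P : ℕ} {W : ℝ} (L0 : ℤ)
    (hW : ∀ n₀ : ℤ, ∑ μ ∈ Ico n₀ (n₀ + P), f μ ≤ W) (T : ℕ) :
    ∑ μ ∈ Ico L0 (L0 + P * T), f μ ≤ T * W := by
  induction T with
  | zero => simp
  | succ T ih =>
    have hsplit : Ico L0 (L0 + P * (T + 1 : ℕ)) = Ico L0 (L0 + P * T) ∪ Ico (L0 + P * T) (L0 + P * T + P) := by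
      rw [Finset.Ico_union_Ico_eq_Ico]
      · congr 1; push_cast; ring
      · have : (0 : ℤ) ≤ P * T := by positivity
        linarith
      · have : (0 : ℤ) ≤ P := by positivity
        linarith
    rw [hsplit, sum_union (Finset.Ico_disjoint_Ico_consecutive _ _ _)]
    have h2 := hW (L0 + P * T)
    have _ := hf
    push_cast
    linarith [ih, h2]

/-- **Ivić's Lemma 6.5 for a `2`-power rational** (cf. Bourgain 2013 (2.24)): if `α_j ≡ b/2^e (mod 1)` with `b`
odd, then `Σ_{|μ| ≤ A_j−1} min(2A_j, 1/(2‖α_jμ‖)) ≤ ((2A_j−1)/2^e + 1)(4A_j + 2^e(1 + log 2^e))`, `A_j = k a^{j+1}`.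
[cite: Ivic1985, Lemma 6.5] [cite: Bourgain2013MoebiusWalsh, (2.24)] -/
theorem mnSum_le_of_twoPower {r : ℕ} (k a : ℕ) (α : Fin r → ℝ) (j : Fin r) {b z : ℤ} (hb : Odd b)
    {e : ℕ} (hα : α j = (b : ℝ) / 2 ^ e + z) :
    VKZeta.mnSum k a α j ≤
      (((2 * VKZeta.Abnd k a j - 1 : ℕ) : ℝ) / 2 ^ e + 1) *
        (4 * (VKZeta.Abnd k a j : ℝ) + 2 ^ e * (1 + Real.log (2 ^ e))) := by
  set A := VKZeta.Abnd k a j with hA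
  set V : ℝ := 2 * (A : ℝ) with hV
  have hV0 : 0 ≤ V := by positivity
  set f : ℤ → ℝ := fun μ => geomBound V ((b : ℝ) * μ / 2 ^ e) with hf
  have hf0 : ∀ μ, 0 ≤ f μ := fun μ => geomBound_nonneg hV0 _
  -- the phase at `μ` reduces to `b μ / 2^e` modulo integers
  have hterm : ∀ μ : ℤ, geomBound V (α j * μ) = f μ := by
    intro μ
    have e1 : α j * μ = (b : ℝ) * μ / 2 ^ e + ((z * μ : ℤ) : ℝ) := by
      rw [hα]; push_cast; ring
    rw [hf]; dsimp only
    rw [e1, VinogradovZetaSum.geomBound_add_int]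
  -- cover `[−(A−1), A−1]` by `T = (2A−1)/2^e + 1` windows
  set P : ℕ := 2 ^ e with hP
  have hP0 : 0 < P := Nat.two_pow_pos e
  set T : ℕ := (2 * A - 1) / P + 1 with hT
  set L0 : ℤ := -((A - 1 : ℕ) : ℤ) with hL0
  have hcover : Icc (-((A - 1 : ℕ) : ℤ)) ((A - 1 : ℕ) : ℤ) ⊆ Ico L0 (L0 + P * T) := by
    intro μ hμ
    rw [mem_Icc] at hμ
    rw [mem_Ico, hL0]
    have h1 : 2 * A - 1 < P * T := by
      rw [hT, Nat.mul_succ]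
      have := Nat.lt_mul_div_succ (2 * A - 1) hP0
      linarith
    have h2 : ((2 * A - 1 : ℕ) : ℤ) < (P : ℤ) * T := by exact_mod_cast h1
    constructor
    · exact hμ.1
    · have h3 : ((A - 1 : ℕ) : ℤ) < -((A - 1 : ℕ) : ℤ) + (P : ℤ) * T := by omega
      linarith [hμ.2]
  have hwin : ∀ n₀ : ℤ, ∑ μ ∈ Ico n₀ (n₀ + P), f μ ≤ 2 * V + 2 ^ e * (1 + Real.log (2 ^ e)) := by
    intro n₀
    rw [hP]; push_cast
    exact sum_window_geomBound_le hb e hV0 n₀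
  have hmain : VKZeta.mnSum k a α j ≤ T * (2 * V + 2 ^ e * (1 + Real.log (2 ^ e))) := by
    unfold VKZeta.mnSum
    rw [← hA]
    calc ∑ μ ∈ Icc (-((A - 1 : ℕ) : ℤ)) ((A - 1 : ℕ) : ℤ), geomBound (2 * (A : ℝ)) (α j * μ)
        = ∑ μ ∈ Icc (-((A - 1 : ℕ) : ℤ)) ((A - 1 : ℕ) : ℤ), f μ := sum_congr rfl fun μ _ => by rw [← hV, hterm]
      _ ≤ ∑ μ ∈ Ico L0 (L0 + P * T), f μ := sum_le_sum_of_subset_of_nonneg hcover fun μ _ _ => hf0 μ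
      _ ≤ T * (2 * V + 2 ^ e * (1 + Real.log (2 ^ e))) := sum_Ico_windows_le hf0 L0 hwin T
  refine hmain.trans ?_
  have hTle : (T : ℝ) ≤ ((2 * A - 1 : ℕ) : ℝ) / 2 ^ e + 1 := by
    rw [hT]; push_cast
    have : (((2 * A - 1) / P : ℕ) : ℝ) ≤ ((2 * A - 1 : ℕ) : ℝ) / 2 ^ e := by
      rw [hP, le_div_iff₀ (by positivity)]
      have := Nat.div_mul_le_self (2 * A - 1) (2 ^ e)
      exact_mod_cast this
    linarith
  have hW0 : 0 ≤ 2 * V + 2 ^ e * (1 + Real.log (2 ^ e)) := by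
    have : 0 ≤ Real.log (2 ^ e) := Real.log_nonneg (one_le_pow₀ (by norm_num))
    positivity
  calc (T : ℝ) * (2 * V + 2 ^ e * (1 + Real.log (2 ^ e)))
      ≤ (((2 * A - 1 : ℕ) : ℝ) / 2 ^ e + 1) * (2 * V + 2 ^ e * (1 + Real.log (2 ^ e))) :=
        mul_le_mul_of_nonneg_right hTle hW0
    _ = _ := by rw [hV]; ring

/-- ★ **The good Korobov factors**: if `α_j ≡ b/2^e (mod 1)` with `b` odd and `2^e ≤ A_j = k a^{j+1}`, then
`Σ_{|μ| ≤ A_j−1} min(2A_j, 1/(2‖α_jμ‖)) ≤ (2A_j)² · (4 + log 2^e)/2^e` — a saving `≍ e·2^{−e}` against the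
trivial bound `(2A_j)²` (`VKZeta.mnSum_le_sq`): `((2A−1)/2^e + 1)(4A + 2^e ℓ) ≤ (2A/2^e + A/2^e)·A(4 + ℓ)`
with `ℓ = 1 + log 2^e`. [cite: Ivic1985, Lemma 6.5 and p. 156] -/
theorem mnSum_le_sq_mul_of_twoPower {r : ℕ} (k a : ℕ) (α : Fin r → ℝ) (j : Fin r) {b z : ℤ} (hb : Odd b)
    {e : ℕ} (hα : α j = (b : ℝ) / 2 ^ e + z) (h2e : (2 : ℝ) ^ e ≤ VKZeta.Abnd k a j) :
    VKZeta.mnSum k a α j ≤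
      (2 * (VKZeta.Abnd k a j : ℝ)) ^ 2 * ((4 + Real.log (2 ^ e)) / 2 ^ e) := by
  have h := mnSum_le_of_twoPower k a α j hb hα
  set A : ℝ := (VKZeta.Abnd k a j : ℝ) with hA
  set Q : ℝ := (2 : ℝ) ^ e with hQ
  have hQ0 : 0 < Q := by rw [hQ]; positivity
  have hA0 : 0 < A := lt_of_lt_of_le hQ0 h2e
  set ℓ : ℝ := 1 + Real.log (2 ^ e) with hℓ
  have hℓ0 : 1 ≤ ℓ := by
    rw [hℓ]
    have : 0 ≤ Real.log (2 ^ e) := Real.log_nonneg (one_le_pow₀ (by norm_num))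
    linarith
  have hcast : (((2 * VKZeta.Abnd k a j - 1 : ℕ) : ℝ)) ≤ 2 * A := by
    have : 2 * VKZeta.Abnd k a j - 1 ≤ 2 * VKZeta.Abnd k a j := Nat.sub_le _ _
    calc (((2 * VKZeta.Abnd k a j - 1 : ℕ) : ℝ)) ≤ ((2 * VKZeta.Abnd k a j : ℕ) : ℝ) := by exact_mod_cast this
      _ = 2 * A := by rw [hA]; push_cast; ring
  have h1 : ((2 * VKZeta.Abnd k a j - 1 : ℕ) : ℝ) / Q + 1 ≤ 2 * A / Q + A / Q := by
    have hAQ : 1 ≤ A / Q := by rw [le_div_iff₀ hQ0, one_mul]; exact h2e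
    have : ((2 * VKZeta.Abnd k a j - 1 : ℕ) : ℝ) / Q ≤ 2 * A / Q := by gcongr
    linarith
  have h2 : 4 * A + Q * ℓ ≤ A * (4 + ℓ) := by
    have : Q * ℓ ≤ A * ℓ := by gcongr
    linarith
  have hR0 : 0 ≤ 4 * A + Q * ℓ := by positivity
  calc VKZeta.mnSum k a α j ≤ (((2 * VKZeta.Abnd k a j - 1 : ℕ) : ℝ) / Q + 1) * (4 * A + Q * ℓ) := h
    _ ≤ (2 * A / Q + A / Q) * (A * (4 + ℓ)) := mul_le_mul h1 h2 hR0 (by positivity)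
    _ = (2 * A) ^ 2 * ((3 * (4 + ℓ) / 4) / Q) := by field_simp; ring
    _ ≤ (2 * A) ^ 2 * ((4 + Real.log (2 ^ e)) / Q) := by
        apply mul_le_mul_of_nonneg_left _ (sq_nonneg _)
        apply div_le_div_of_nonneg_right _ hQ0.le
        rw [hℓ]
        have : 0 ≤ Real.log (2 ^ e) := Real.log_nonneg (one_le_pow₀ (by norm_num))
        linarith

end Summit.ValiantsHypothesis.ValiantsHypothesis.Theorems.LiouvilleSarnak.AlignedTypeI.CharactersModTwoN
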